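import Mathlib
import HarnessLib
import Summits.HubbardSuperconductivity.HubbardSuperconductivity.Theses.ChiralWindow
import Summits.HubbardSuperconductivity.HubbardSuperconductivity.Theorems.ChiralWindowCwThesisUFreeAnchor
import Summits.HubbardSuperconductivity.HubbardSuperconductivity.Theorems.ChiralWindowCwChannelInfContinuousChemicalPotential
import Summits.HubbardSuperconductivity.HubbardSuperconductivity.Theorems.ChiralWindowCwChannelInfContinuousFilling
import Summits.HubbardSuperconductivity.HubbardSuperconductivity.Theorems.ChiralWindowCwKLChiralWindowStubKlFillingLower
import Summits.HubbardSuperconductivity.HubbardSuperconductivity.Theorems.ChiralWindowCwChiralConstructionFillingBelowSevenTenths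

/-!
# Crux `CwChiralConstruction` (stmt-HubbardSuperconductivity-1740), line `ladder-scale-transfer` rev c7-1:
# stub (P1) `stub_kptOfPointLeading` — from a `U = 1` leading inequality at a band level to (Kpt)

Route `HubbardSuperconductivity/ChiralWindow`, rank-2 crux ("the programme"). Support file
(`--supports stmt-HubbardSuperconductivity-1740`), lead seat c7, 2026-08-17.

Write `ε₀ = squareDispersion 1 0` (free band `-2(cos kx + cos ky)`, band `(-4, 4)`), `Λ_U(μ,χ) = channelInf ε₀ μ U χ`
(bottom of the second-order pairing vertex over the normalised gap functions of the `D₄` irrep `χ` on the level-`μ`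
Fermi curve), `μ(n) = chemicalPotentialOfDensity ε₀ n`, `n(μ) = KohnLuttinger.filling ε₀ μ`.

The KL input of the crux is the POINT datum (Kpt): `B₁g` leads every other channel by `γU²` at ONE window doping
`δ₀ ∈ [3/10, 12/25]` for all small `U`. This file is the pure-logic transfer from a `U = 1` certificate at a band
level `μ ∈ [-111/100, -21/25]`:

* the LANDED certified fillings `13/25 ≤ n(-111/100)` (`stub_klFillingLower`) and `n(-21/25) < 7/10`
  (`stub_fillingBelowSevenTenths`) with `monotone_filling` put `n(μ) ∈ [13/25, 7/10)`, i.e.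
  `δ₀ := 1 - n(μ) ∈ (3/10, 12/25]`;
* `chemicalPotentialOfDensity_eq_of_filling_eq` (the free filling is continuous and strictly increasing on the band)
  gives `μ(1 - δ₀) = μ(n(μ)) = μ`;
* `CwThesis.leading_of_certificateOne` turns the `U = 1` margin `γ` into the margin `γU²` for every `U ∈ (0, 1)`
  (`U²`-homogeneity of the bottoms off `A1g`, bare-`U` penalty for `A1g`).

No definitions; everything is proved. References: S. Raghu, S. A. Kivelson, D. J. Scalapino, Phys. Rev. B 81 (2010)
224505, §II (7), (13), §III; W. Kohn, J. M. Luttinger, Phys. Rev. Lett. 15 (1965) 524.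
-/

noncomputable section

namespace Summit.HubbardSuperconductivity.HubbardSuperconductivity.Theorems

set_option linter.dupNamespace false

open MeasureTheory Literature.MathematicalPhysics.QuantumLattice Set

/-- **The free filling on the level range `[-111/100, -21/25]` lies in `[13/25, 7/10)`**: the certified end fillings
`13/25 ≤ n(-111/100)` and `n(-21/25) < 7/10` and the monotonicity of the free filling. [folklore] -/
theorem kptOfPointLeading_filling_mem_Ico {μ : ℝ} (hμ : μ ∈ Set.Icc (-(111:ℝ) / 100) (-(21:ℝ) / 25)) :
    KohnLuttinger.filling (squareDispersion 1 0) μ ∈ Set.Ico (13 / 25 : ℝ) (7 / 10) := by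
  refine ⟨stub_klFillingLower.trans (monotone_filling ?_), (monotone_filling hμ.2).trans_lt stub_fillingBelowSevenTenths⟩
  have h := hμ.1
  norm_num at h ⊢
  exact h

/-- **The chemical potential of the free filling at a level of the range is that level**: `μ(n(μ)) = μ` for
`μ ∈ [-111/100, -21/25] ⊂ (-4, 0)` (the free filling is continuous and strictly increasing on the band, so the
threshold defining `chemicalPotentialOfDensity` is attained exactly at `μ`). Stated with the density written as
`1 - (1 - n(μ))`, the form in which the doping `δ₀ := 1 - n(μ)` enters (Kpt). [folklore] -/
theorem kptOfPointLeading_level_eq {μ : ℝ} (hμ : μ ∈ Set.Icc (-(111:ℝ) / 100) (-(21:ℝ) / 25)) :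
    chemicalPotentialOfDensity (squareDispersion 1 0)
        (1 - (1 - KohnLuttinger.filling (squareDispersion 1 0) μ)) = μ := by
  have hlo := (kptOfPointLeading_filling_mem_Ico hμ).1
  refine chemicalPotentialOfDensity_eq_of_filling_eq (by linarith) ⟨?_, ?_⟩ (sub_sub_cancel _ _).symm
  · linarith [hμ.1]
  · linarith [hμ.2]

/-- **Stub (P1) `stub_kptOfPointLeading` — from a `U = 1` leading inequality at a band level to (Kpt).** If at some
`μ ∈ [-111/100, -21/25]` the `U = 1` channel bottoms satisfy `Λ₁(μ, B1g) + γ ≤ Λ₁(μ, χ)` for every `χ ≠ B1g`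
(`γ > 0`), then (Kpt) holds at the doping `δ₀ := 1 - n(μ) ∈ [3/10, 12/25]` with `γ' := γ`, `U₁ := 1`: the landed
fillings `13/25 ≤ n(-111/100)`, `n(-21/25) < 7/10` and `monotone_filling` locate `δ₀`; `μ(1 - δ₀) = μ`
(`kptOfPointLeading_level_eq`); `CwThesis.leading_of_certificateOne` turns the `U = 1` margin `γ` into `γU²` for
every `U ∈ (0, 1)`. [cite: RaghuKivelsonScalapino2010, §II (7), (13)] -/
theorem stub_kptOfPointLeading :
    ∀ μ ∈ Set.Icc (-(111:ℝ) / 100) (-(21:ℝ) / 25), ∀ γ : ℝ, 0 < γ →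
      (∀ χ : D4Irrep, χ ≠ D4Irrep.B1g →
        channelInf (squareDispersion 1 0) μ 1 D4Irrep.B1g + γ ≤ channelInf (squareDispersion 1 0) μ 1 χ) →
      ∃ δ₀ ∈ Set.Icc (3/10 : ℝ) (12/25), ∃ γ' U₁ : ℝ, 0 < γ' ∧ 0 < U₁ ∧ ∀ U ∈ Set.Ioo (0:ℝ) U₁,
        ∀ χ : D4Irrep, χ ≠ D4Irrep.B1g →
          channelInf (squareDispersion 1 0) (chemicalPotentialOfDensity (squareDispersion 1 0) (1 - δ₀)) U D4Irrep.B1g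
              + γ' * U ^ 2 ≤
            channelInf (squareDispersion 1 0) (chemicalPotentialOfDensity (squareDispersion 1 0) (1 - δ₀)) U χ := by
  intro μ hμ γ hγ hcert
  obtain ⟨hlo, hhi⟩ := kptOfPointLeading_filling_mem_Ico hμ
  have hμI : μ ∈ Set.Ioo (-4 : ℝ) 0 := ⟨by linarith [hμ.1], by linarith [hμ.2]⟩
  refine ⟨1 - KohnLuttinger.filling (squareDispersion 1 0) μ, ⟨by linarith, by linarith⟩, γ, 1, hγ, one_pos,
    fun U hU χ hχ => ?_⟩
  rw [kptOfPointLeading_level_eq hμ]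
  exact CwThesis.leading_of_certificateOne hμI hcert U hU χ hχ

end Summit.HubbardSuperconductivity.HubbardSuperconductivity.Theorems
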